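import Literature.Probability.Process.MatrixRenewalCoefficients
import HarnessLib

/-!
# The coefficient renewal theorem for matrix renewal sequences — the PERIOD-TWO (ℤ/2-graded) case

Topic `Literature/Probability/Process` (renewal theory; continues `MatrixRenewalCoefficients.lean` — `RenewalKernelPair`,
`RenewalKernelPair.Critical`, and the coefficient renewal theorem `RenewalKernelPair.tendsto_coeff`, whose docstring lists «the periodic
case» as NOT claimed).  Lane «pcv-sawmu» (CriticalPhenomena venture), a-p2 g21 — abstracted from the strip instance
`RandomPlanarGeometry/HexSAWStripBridgeLengthPointwiseLaw.lean` (bridges of a honeycomb strip counted by length: nearest-neighbour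
paths on a bipartite level graph, hence period two).

THE SETTING.  A matrix renewal pair `(M, D)` on a finite level set `ι` (`D(m) = M(m) + Σ_{i+j=m} M(i) D(j)`) which is `ℤ/2`-GRADED by
level parities `χ : ι → {0,1}`: `M(n)_{ab} = D(n)_{ab} = 0` unless `n ≡ χ_a + χ_b (mod 2)` (`Graded₂`).  Then `D(n)_{aa} > 0` forces `n`
even: the pair has PERIOD TWO and `tendsto_coeff` does not apply.

THE DEVICE (Feller XIII.3 for matrices).  The PARITY-SHIFTED ("hat") pair `M̂(k)_{ab} := M(2k + χ_a − χ_b)_{ab}`,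
`D̂(k)_{ab} := D(2k + χ_a − χ_b)_{ab}` (negative lengths read as `0`) — on generating functions the similarity `diag(1, s)` followed by
`s² ↦ s` — satisfies the SAME renewal equation exactly (`hat_ren`: `χ_a − χ_c` and `χ_c − χ_b` add up), so `hat K χ` is again a
`RenewalKernelPair`; its generating functions are `t^e · D_{ab}(t)` with `s = t²`, `e ∈ {−1,0,1}` (`hat_gf`), so the Abelian limit
DOUBLES (`hat_abel`: `(1 − t²) t^e D(t) = (1 + t) t^e · (1 − t) D(t) → 2L`); summability and the finite first moment transfer, and
aperiodicity is required only ALONG THE PARITY CLASS: `gcd {k : D(2k)_{oo} > 0} = 1` (`hat_critical`).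

THE THEOREM (`tendsto_hat_coeff`, `tendsto_coeff_even`, `tendsto_coeff_odd`).  Under the four non-periodic hypotheses of `Critical`
for `K` and parity-class aperiodicity at one level: `D(2k)_{ab} → 2L_{ab}` if `χ_a = χ_b`, `D(2k+1)_{ab} → 2L_{ab}` if `χ_a ≠ χ_b`
— Feller's `u_{nλ} → λ/μ` with `λ = 2`, for matrices.

Sources of the TEMPLATE: W. Feller, *An Introduction to Probability Theory and its Applications* I (3rd ed. 1968) XIII.3 (periodic
recurrent events), XIII.11; N. Madras, G. Slade, *The Self-Avoiding Walk* (1993) Theorem 4.2.2 (b); E. Seneta (1973) Chapter 6.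

Label: LANE THEOREM on a CLASSICAL TEMPLATE (own arrangement, a-p2 g21).  NOT claimed: periods `d ≥ 3` (the same device with a
`ℤ/d`-grading and `d`-th roots), rates, infinite `ι`.
-/

noncomputable section

open Finset Filter Topology

namespace Literature.Probability.Process

namespace RenewalKernelPair

variable {ι : Type*} [Fintype ι] [DecidableEq ι] (K : RenewalKernelPair ι) (χ : ι → ℕ)

/-! ### §1 ℤ/2-graded renewal pairs and the parity-shifted ("hat") pair -/

/-- A `ℤ/2`-GRADING of a matrix renewal pair by level parities `χ_a ∈ {0,1}`: pieces and sequences `a → b` only have lengths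
`n ≡ χ_a + χ_b (mod 2)` (e.g. nearest-neighbour paths between levels of a bipartite level graph). [cite: Feller1968, XIII.3 (periodic recurrent events); lane «pcv-sawmu» a-p2 g21 — setting] -/
structure Graded₂ : Prop where
  /-- the parities are `0` or `1` -/
  le_one : ∀ a, χ a ≤ 1
  /-- off-parity pieces vanish -/
  M_zero : ∀ n a b, ¬ Even (n + χ a + χ b) → K.M n a b = 0
  /-- off-parity sequences vanish -/
  D_zero : ∀ n a b, ¬ Even (n + χ a + χ b) → K.D n a b = 0

/-- The hat length `2k + χ_a − χ_b ∈ ℤ` (plumbing). [cite: Feller1968, XIII.3; lane plumbing] -/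
def glen (k : ℕ) (a b : ι) : ℤ := 2 * (k : ℤ) + χ a - χ b

/-- The slice of a matrix sequence at an integer length (`0` at negative lengths) (plumbing). [cite: Feller1968, XIII.3; lane plumbing] -/
def zslice (A : ℕ → Matrix ι ι ℝ) (τ : ℤ) (a b : ι) : ℝ := if 0 ≤ τ then A τ.toNat a b else 0

omit [Fintype ι] [DecidableEq ι] in
/-- `zslice` at a natural length. [cite: Feller1968, XIII.3; lane plumbing] -/
theorem zslice_natCast (A : ℕ → Matrix ι ι ℝ) (n : ℕ) (a b : ι) : zslice A (n : ℤ) a b = A n a b := by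
  simp [zslice]

omit [Fintype ι] [DecidableEq ι] in
/-- `zslice` vanishes at negative lengths. [cite: Feller1968, XIII.3; lane plumbing] -/
theorem zslice_neg (A : ℕ → Matrix ι ι ℝ) {τ : ℤ} (h : τ < 0) (a b : ι) : zslice A τ a b = 0 := by
  simp [zslice, not_le.2 h]

/-- The hat one-piece kernel `M̂(k)_{ab} := M(2k + χ_a − χ_b)_{ab}`. [cite: Feller1968, XIII.3 (reduction of a periodic renewal sequence); lane «pcv-sawmu» a-p2 g21] -/
def hatM (k : ℕ) : Matrix ι ι ℝ := fun a b => zslice K.M (glen χ k a b) a b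

/-- The hat all-sequences kernel `D̂(k)_{ab} := D(2k + χ_a − χ_b)_{ab}`. [cite: Feller1968, XIII.3; lane «pcv-sawmu» a-p2 g21] -/
def hatD (k : ℕ) : Matrix ι ι ℝ := fun a b => zslice K.D (glen χ k a b) a b

variable {K χ}

/-- ★★ **The hat pair satisfies the matrix renewal equation** `D̂(k) = M̂(k) + Σ_{i+j=k} M̂(i) D̂(j)` (for a `ℤ/2`-graded pair): in
`Σ_{i+j=n} M(i)_{ac} D(j)_{cb}` only `i ≡ χ_a + χ_c` contributes, `i = 2i′ + χ_a − χ_c`, `j = 2j′ + χ_c − χ_b`, `i′ + j′ = k`.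
[cite: Feller1968, XIII.3; lane «pcv-sawmu» a-p2 g21 — own arrangement] -/
theorem hat_ren (hK : K.Graded₂ χ) (k : ℕ) :
    hatD K χ k = hatM K χ k + ∑ p ∈ antidiagonal k, hatM K χ p.1 * hatD K χ p.2 := by
  ext a b
  have hχa := hK.le_one a; have hχb := hK.le_one b
  set σ : ℤ := glen χ k a b with hσdef
  rw [Matrix.add_apply, Matrix.sum_apply]
  simp only [Matrix.mul_apply]
  rw [sum_comm]
  -- case `σ < 0` (`k = 0`, `χ_a = 0`, `χ_b = 1`): everything vanishes
  rcases lt_or_ge σ 0 with hσ | hσ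
  · have h0 : hatD K χ k a b = 0 := by rw [hatD]; exact zslice_neg _ (by rw [← hσdef]; exact hσ) a b
    have h1 : hatM K χ k a b = 0 := by rw [hatM]; exact zslice_neg _ (by rw [← hσdef]; exact hσ) a b
    rw [h0, h1, zero_add]
    symm
    refine sum_eq_zero fun c _ => sum_eq_zero fun p hp => ?_
    rw [HasAntidiagonal.mem_antidiagonal] at hp
    have hχc := hK.le_one c
    have hk : k = 0 := by rw [hσdef, glen] at hσ; omega
    -- one of the two hat lengths is negative
    rcases lt_or_ge (glen χ p.1 a c) 0 with h | h
    · rw [hatM, zslice_neg _ h, zero_mul]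
    · have : glen χ p.2 c b < 0 := by
        rw [glen] at h ⊢; rw [hσdef, glen] at hσ; omega
      rw [hatD, zslice_neg _ this, mul_zero]
  -- `σ = n ≥ 0`
  obtain ⟨n, hn⟩ : ∃ n : ℕ, (n : ℤ) = σ := ⟨σ.toNat, Int.toNat_of_nonneg hσ⟩
  have hD : hatD K χ k a b = K.D n a b := by
    show zslice K.D (glen χ k a b) a b = _; rw [← hσdef, ← hn, zslice_natCast]
  have hM : hatM K χ k a b = K.M n a b := by
    show zslice K.M (glen χ k a b) a b = _; rw [← hσdef, ← hn, zslice_natCast]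
  rw [hD, hM, K.ren n, Matrix.add_apply, Matrix.sum_apply]
  congr 1
  simp only [Matrix.mul_apply]
  rw [sum_comm]
  refine sum_congr rfl fun c _ => ?_
  have hχc := hK.le_one c
  set δ : ℤ := (χ a : ℤ) - χ c with hδ
  -- both sides as sums of `f τ := M̃(τ)_{ac} D̃(σ − τ)_{cb}` over integer lengths
  set f : ℤ → ℝ := fun τ => zslice K.M τ a c * zslice K.D (σ - τ) c b with hfdef
  have hL : ∑ p ∈ antidiagonal n, K.M p.1 a c * K.D p.2 c b = ∑ i ∈ range (n + 1), f (i : ℤ) := by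
    rw [Nat.sum_antidiagonal_eq_sum_range_succ_mk]
    refine sum_congr rfl fun i hi => ?_
    rw [mem_range] at hi
    rw [hfdef]; simp only
    rw [zslice_natCast, show σ - (i : ℤ) = ((n - i : ℕ) : ℤ) by push_cast [Nat.cast_sub (show i ≤ n by omega)]; omega,
      zslice_natCast]
  have hR : ∑ p ∈ antidiagonal k, hatM K χ p.1 a c * hatD K χ p.2 c b = ∑ i ∈ range (k + 1), f (2 * (i : ℤ) + δ) := by
    rw [Nat.sum_antidiagonal_eq_sum_range_succ_mk]
    refine sum_congr rfl fun i hi => ?_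
    rw [mem_range] at hi
    rw [hfdef, hatM, hatD]; simp only
    have e1 : glen χ i a c = 2 * (i : ℤ) + δ := by rw [hδ, glen]; ring
    have e2 : glen χ (k - i) c b = σ - (2 * (i : ℤ) + δ) := by
      rw [hσdef, hδ, glen, glen]; push_cast [Nat.cast_sub (show i ≤ k by omega)]; ring
    rw [e1, e2]
  rw [hL, hR]
  have hinj1 : Set.InjOn (fun i : ℕ => (i : ℤ)) (range (n + 1) : Finset ℕ) := fun i _ j _ h => by simpa using h
  have hinj2 : Set.InjOn (fun i : ℕ => 2 * (i : ℤ) + δ) (range (k + 1) : Finset ℕ) := fun i _ j _ h => by simpa using h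
  rw [← sum_image hinj1, ← sum_image hinj2]
  set S₁ : Finset ℤ := (range (n + 1)).image (fun i : ℕ => (i : ℤ)) with hS₁
  set S₂ : Finset ℤ := (range (k + 1)).image (fun i : ℕ => 2 * (i : ℤ) + δ) with hS₂
  -- terms of `S₂` outside `S₁` vanish (a negative length), terms of `S₁` outside `S₂` vanish (parity)
  have hvan2 : ∀ τ ∈ S₂, τ ∉ S₁ → f τ = 0 := by
    intro τ hτ hτ1
    rw [hS₂, mem_image] at hτ
    obtain ⟨i, hi, rfl⟩ := hτ
    rw [mem_range] at hi
    have hout : 2 * (i : ℤ) + δ < 0 ∨ σ - (2 * (i : ℤ) + δ) < 0 := by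
      by_contra hcon
      rw [not_or, not_lt, not_lt] at hcon
      apply hτ1
      rw [hS₁, mem_image]
      exact ⟨(2 * (i : ℤ) + δ).toNat, mem_range.2 (by omega), (by omega : (((2 * (i : ℤ) + δ).toNat : ℕ) : ℤ) = 2 * (i : ℤ) + δ)⟩
    rw [hfdef]; simp only
    rcases hout with h | h
    · rw [zslice_neg _ h, zero_mul]
    · rw [zslice_neg _ h, mul_zero]
  have hvan1 : ∀ τ ∈ S₁, τ ∉ S₂ → f τ = 0 := by
    intro τ hτ hτ2
    rw [hS₁, mem_image] at hτ
    obtain ⟨i, hi, rfl⟩ := hτ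
    rw [mem_range] at hi
    have hpar : ¬ Even ((i : ℤ) + χ a + χ c) := by
      rintro ⟨m, hm⟩
      apply hτ2
      rw [hS₂, mem_image]
      have hn' := hn
      rw [hσdef, glen] at hn'
      exact ⟨(((i : ℤ) - δ) / 2).toNat, mem_range.2 (by omega),
        (by omega : 2 * (((((i : ℤ) - δ) / 2).toNat : ℕ) : ℤ) + δ = (i : ℤ))⟩
    rw [hfdef]; simp only
    rw [zslice_natCast, hK.M_zero i a c (fun ⟨m, hm⟩ => hpar ⟨(m : ℤ), by omega⟩), zero_mul]
  have e1 : ∑ τ ∈ S₁ ∩ S₂, f τ = ∑ τ ∈ S₁, f τ :=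
    sum_subset inter_subset_left fun τ h1 hn' => hvan1 τ h1 fun h2 => hn' (mem_inter.2 ⟨h1, h2⟩)
  have e2 : ∑ τ ∈ S₁ ∩ S₂, f τ = ∑ τ ∈ S₂, f τ :=
    sum_subset inter_subset_right fun τ h2 hn' => hvan2 τ h2 fun h1 => hn' (mem_inter.2 ⟨h1, h2⟩)
  rw [← e1, e2]

/-- ★ **The hat pair** of a `ℤ/2`-graded renewal pair (again a `RenewalKernelPair`). [cite: Feller1968, XIII.3; lane «pcv-sawmu» a-p2 g21] -/
def hat (K : RenewalKernelPair ι) (χ : ι → ℕ) (hK : K.Graded₂ χ) : RenewalKernelPair ι where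
  M := hatM K χ
  D := hatD K χ
  M_nonneg := fun _ a b => by
    rw [hatM]; simp only [zslice]; split_ifs
    · exact K.M_nonneg _ a b
    · exact le_rfl
  D_nonneg := fun _ a b => by
    rw [hatD]; simp only [zslice]; split_ifs
    · exact K.D_nonneg _ a b
    · exact le_rfl
  ren := hat_ren hK


/-! ### §2 Criticality transfers to the hat pair (the Abelian limit doubles) -/

/-- Even part of a real series whose odd terms vanish (plumbing; statement-twin of the strip file's lemma, hence `private`).
[cite: Feller1968, XIII.3; lane plumbing] -/
private theorem hasSum_even_part' {f : ℕ → ℝ} {S : ℝ} (hf : HasSum f S) (hodd : ∀ k, f (2 * k + 1) = 0) :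
    HasSum (fun k => f (2 * k)) S := by
  have he : Summable fun k => f (2 * k) := hf.summable.comp_injective (i := fun k : ℕ => 2 * k) fun x y h => by simpa using h
  have ho : Summable fun k => f (2 * k + 1) := hf.summable.comp_injective (i := fun k : ℕ => 2 * k + 1) fun x y h => by
    simpa using h
  have h := HasSum.even_add_odd he.hasSum ho.hasSum
  have hB : ∑' k, f (2 * k + 1) = 0 := by rw [tsum_congr hodd, tsum_zero]
  rw [hB, add_zero] at h
  rw [hf.unique h]; exact he.hasSum

/-- Odd part of a real series whose even terms vanish (plumbing; `private` for the same reason). [cite: Feller1968, XIII.3; lane plumbing] -/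
private theorem hasSum_odd_part' {f : ℕ → ℝ} {S : ℝ} (hf : HasSum f S) (heven : ∀ k, f (2 * k) = 0) :
    HasSum (fun k => f (2 * k + 1)) S := by
  have he : Summable fun k => f (2 * k) := hf.summable.comp_injective (i := fun k : ℕ => 2 * k) fun x y h => by simpa using h
  have ho : Summable fun k => f (2 * k + 1) := hf.summable.comp_injective (i := fun k : ℕ => 2 * k + 1) fun x y h => by
    simpa using h
  have h := HasSum.even_add_odd he.hasSum ho.hasSum
  have hA : ∑' k, f (2 * k) = 0 := by rw [tsum_congr heven, tsum_zero]
  rw [hA, zero_add] at h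
  rw [hf.unique h]; exact ho.hasSum

/-- The hat generating function is the parity-class generating function: `Σ_k D̂(k)_{ab} t^{2k} = t^e · Σ_m D(m)_{ab} t^m` for `0 < t < 1`,
with `e = χ_b − χ_a ∈ {−1, 0, 1}`. [cite: Feller1968, XIII.3; lane «pcv-sawmu» a-p2 g21] -/
theorem hat_gf (hK : K.Graded₂ χ) (a b : ι) (hsum : ∀ s : ℝ, 0 ≤ s → s < 1 → Summable fun m => K.D m a b * s ^ m) :
    ∃ e : ℤ, ∀ t ∈ Set.Ioo (0 : ℝ) 1,
      HasSum (fun k : ℕ => hatD K χ k a b * (t ^ 2) ^ k) (t ^ e * ∑' m : ℕ, K.D m a b * t ^ m) := by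
  have hχa := hK.le_one a; have hχb := hK.le_one b
  have hhat : ∀ k n : ℕ, (n : ℤ) = glen χ k a b → hatD K χ k a b = K.D n a b := by
    intro k n hn
    show zslice K.D (glen χ k a b) a b = _
    rw [← hn, zslice_natCast]
  have hD : ∀ t ∈ Set.Ioo (0 : ℝ) 1, HasSum (fun n : ℕ => K.D n a b * t ^ n) (∑' m : ℕ, K.D m a b * t ^ m) :=
    fun t ht => (hsum t ht.1.le ht.2).hasSum
  rcases Nat.even_or_odd (χ a + χ b) with hpar | hpar
  · -- same parity: even lengths, `D̂(k) = D(2k)`, `e = 0`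
    have hab : χ a = χ b := by rcases hpar with ⟨m, hm⟩; omega
    refine ⟨0, fun t ht => ?_⟩
    rw [zpow_zero, one_mul]
    have h := hasSum_even_part' (hD t ht) fun k => by
      rw [hK.D_zero (2 * k + 1) a b (fun ⟨m, hm⟩ => by omega), zero_mul]
    refine h.congr_fun fun k => ?_
    rw [hhat k (2 * k) (by rw [glen, hab]; push_cast; ring), ← pow_mul]
  · have hab : (χ a = 0 ∧ χ b = 1) ∨ (χ a = 1 ∧ χ b = 0) := by rcases hpar with ⟨m, hm⟩; omega
    rcases hab with ⟨ha0, hb1⟩ | ⟨ha1, hb0⟩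
    · -- lengths `2k − 1`: `D̂(0) = 0`, `D̂(k+1) t^{2k+2} = t · D(2k+1) t^{2k+1}`, `e = 1`
      refine ⟨1, fun t ht => ?_⟩
      rw [zpow_one]
      have h := hasSum_odd_part' (hD t ht) fun k => by
        rw [hK.D_zero (2 * k) a b (fun ⟨m, hm⟩ => by omega), zero_mul]
      have h1 : HasSum (fun k : ℕ => hatD K χ (k + 1) a b * (t ^ 2) ^ (k + 1)) (t * ∑' m : ℕ, K.D m a b * t ^ m) := by
        refine (h.mul_left t).congr_fun fun k => ?_
        rw [hhat (k + 1) (2 * k + 1) (by rw [glen, ha0, hb1]; push_cast; ring), ← pow_mul]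
        ring
      have h0 : hatD K χ 0 a b = 0 := by
        show zslice K.D (glen χ 0 a b) a b = 0
        exact zslice_neg _ (by rw [glen, ha0, hb1]; norm_num) a b
      exact (hasSum_nat_add_iff' (f := fun k : ℕ => hatD K χ k a b * (t ^ 2) ^ k) 1).1
        (by rw [sum_range_one, h0, zero_mul, sub_zero]; exact h1)
    · -- lengths `2k + 1`: `e = −1`
      refine ⟨-1, fun t ht => ?_⟩
      rw [zpow_neg, zpow_one]
      have h := hasSum_odd_part' (hD t ht) fun k => by
        rw [hK.D_zero (2 * k) a b (fun ⟨m, hm⟩ => by omega), zero_mul]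
      refine (h.mul_left t⁻¹).congr_fun fun k => ?_
      rw [hhat k (2 * k + 1) (by rw [glen, ha1, hb0]; push_cast; ring), ← pow_mul, pow_succ]
      field_simp [ht.1.ne']

/-- ★★ **The Abelian limit doubles**: if `(1 − s) Σ_m D(m)_{ab} s^m → L_{ab}` then `(1 − s) Σ_k D̂(k)_{ab} s^k → 2L_{ab}` (`s = t²`).
[cite: Feller1968, XIII.3, XIII.5; lane «pcv-sawmu» a-p2 g21] -/
theorem hat_abel (hK : K.Graded₂ χ) (a b : ι) (hsum : ∀ s : ℝ, 0 ≤ s → s < 1 → Summable fun m => K.D m a b * s ^ m) {L : ℝ}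
    (habel : Tendsto (fun s : ℝ => (1 - s) * ∑' m : ℕ, K.D m a b * s ^ m) (𝓝[<] 1) (𝓝 L)) :
    Tendsto (fun s : ℝ => (1 - s) * ∑' k : ℕ, hatD K χ k a b * s ^ k) (𝓝[<] 1) (𝓝 (2 * L)) := by
  obtain ⟨e, he⟩ := hat_gf hK a b hsum
  have hsqrt : Tendsto Real.sqrt (𝓝[<] (1 : ℝ)) (𝓝[<] 1) := by
    refine tendsto_nhdsWithin_of_tendsto_nhds_of_eventually_within _ ?_ ?_
    · have := Real.continuous_sqrt.tendsto (1 : ℝ)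
      rw [Real.sqrt_one] at this
      exact this.mono_left nhdsWithin_le_nhds
    · filter_upwards [Ioo_mem_nhdsLT zero_lt_one] with s hs
      rw [Set.mem_Iio, Real.sqrt_lt' zero_lt_one, one_pow]
      exact hs.2
  have hG : Tendsto (fun t : ℝ => (1 + t) * t ^ e * ((1 - t) * ∑' m : ℕ, K.D m a b * t ^ m)) (𝓝[<] 1)
      (𝓝 ((1 + 1) * (1 : ℝ) ^ e * L)) := by
    refine Tendsto.mul (Tendsto.mul ?_ ?_) habel
    · exact ((continuous_const.add continuous_id).tendsto 1).mono_left nhdsWithin_le_nhds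
    · exact ((continuousAt_zpow₀ 1 e (Or.inl one_ne_zero)).tendsto).mono_left nhdsWithin_le_nhds
  rw [one_zpow, mul_one, show (1 : ℝ) + 1 = 2 by norm_num] at hG
  refine ((hG.comp hsqrt).congr' ?_)
  filter_upwards [Ioo_mem_nhdsLT zero_lt_one] with s hs
  have ht : Real.sqrt s ∈ Set.Ioo (0 : ℝ) 1 :=
    ⟨Real.sqrt_pos.2 hs.1, by rw [Real.sqrt_lt' zero_lt_one, one_pow]; exact hs.2⟩
  have hs2 : Real.sqrt s ^ 2 = s := Real.sq_sqrt hs.1.le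
  simp only [Function.comp]
  have hts : ∑' k : ℕ, hatD K χ k a b * s ^ k = Real.sqrt s ^ e * ∑' m : ℕ, K.D m a b * Real.sqrt s ^ m := by
    have := (he _ ht).tsum_eq; simp only [hs2] at this; exact this
  rw [hts]
  have : (1 : ℝ) - s = (1 + Real.sqrt s) * (1 - Real.sqrt s) := by linear_combination hs2
  rw [this]; ring

/-- ★★ **Criticality of the hat pair**: the four non-periodic hypotheses of `Critical` for `K` (summable generating functions, Abelian
limits `L > 0`, finite first moment) together with aperiodicity ALONG THE PARITY CLASS (`gcd {k : D(2k)_{oo} > 0} = 1` at one level)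
make the hat pair `Critical` with limits `2L`. [cite: Feller1968, XIII.3 (periodic case), XIII.11; Seneta1973, Chapter 6; lane «pcv-sawmu» a-p2 g21 — own arrangement] -/
theorem hat_critical (hK : K.Graded₂ χ) {L : ι → ι → ℝ}
    (hsum : ∀ (a b : ι) (s : ℝ), 0 ≤ s → s < 1 → Summable fun m => K.D m a b * s ^ m)
    (habel : ∀ a b : ι, Tendsto (fun s : ℝ => (1 - s) * ∑' m, K.D m a b * s ^ m) (𝓝[<] 1) (𝓝 (L a b)))
    (hpos : ∀ a b : ι, 0 < L a b) (hmean : ∀ a b : ι, Summable fun j : ℕ => (j : ℝ) * K.M j a b)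
    (haper : ∃ o : ι, Nat.setGcd {k : ℕ | 0 < K.D (2 * k) o o} = 1) :
    (hat K χ hK).Critical fun a b => 2 * L a b := by
  refine ⟨fun a b s hs0 hs1 => ?_, fun a b => hat_abel hK a b (hsum a b) (habel a b), fun a b => by linarith [hpos a b],
    fun a b => ?_, ?_⟩
  · -- summability of the hat generating function
    show Summable fun k : ℕ => hatD K χ k a b * s ^ k
    have hχa := hK.le_one a; have hχb := hK.le_one b
    rcases hs0.eq_or_lt with hs00 | hs0'
    · refine summable_of_ne_finset_zero (s := {0}) fun k hk => ?_
      rw [mem_singleton] at hk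
      rw [← hs00, zero_pow hk, mul_zero]
    set t : ℝ := Real.sqrt s with htdef
    have ht0 : 0 < t := Real.sqrt_pos.2 hs0'
    have ht1 : t < 1 := by rw [htdef, Real.sqrt_lt' zero_lt_one, one_pow]; exact hs1
    have hs2 : t ^ 2 = s := Real.sq_sqrt hs0
    set δ : ℤ := (χ a : ℤ) - χ b with hδ
    set φ : ℕ → ℕ := fun k => (2 * (k : ℤ) + δ).toNat with hφdef
    have hφ : Function.Injective φ := by
      intro k k' h
      rw [hφdef] at h; simp only at h; omega
    set g : ℕ → ℝ := fun n => K.D n a b * t ^ n with hgdef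
    have hg0 : ∀ n, 0 ≤ g n := fun n => mul_nonneg (K.D_nonneg n a b) (pow_nonneg ht0.le _)
    have hgφ : Summable (g ∘ φ) := (hsum a b t ht0.le ht1).comp_injective hφ
    refine (hgφ.mul_left t⁻¹).of_nonneg_of_le (fun k => mul_nonneg ?_ (pow_nonneg hs0 _)) fun k => ?_
    · show 0 ≤ zslice K.D (glen χ k a b) a b
      simp only [zslice]; split_ifs
      · exact K.D_nonneg _ a b
      · exact le_rfl
    · show zslice K.D (glen χ k a b) a b * s ^ k ≤ t⁻¹ * (g ∘ φ) k
      simp only [Function.comp, hgdef]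
      rcases lt_or_ge (glen χ k a b) 0 with hneg | hnn
      · rw [zslice_neg _ hneg, zero_mul]
        exact mul_nonneg (inv_nonneg.2 ht0.le) (hg0 _)
      · have hn : ((φ k : ℕ) : ℤ) = glen χ k a b := by rw [hφdef]; simp only; rw [hδ, glen] at *; omega
        rw [← hn, zslice_natCast, ← hs2, ← pow_mul]
        -- `t^{2k} ≤ t⁻¹ t^{φ k}` since `φ k ≤ 2k + 1`
        have hle : φ k ≤ 2 * k + 1 := by have := hn; rw [glen] at this; omega
        have hpow : t ^ (2 * k) ≤ t⁻¹ * t ^ (φ k) := by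
          rw [show t⁻¹ * t ^ (φ k) = t ^ (φ k) / t from by ring, le_div_iff₀ ht0, ← pow_succ]
          exact pow_le_pow_of_le_one ht0.le ht1.le hle
        calc K.D (φ k) a b * t ^ (2 * k) ≤ K.D (φ k) a b * (t⁻¹ * t ^ (φ k)) :=
              mul_le_mul_of_nonneg_left hpow (K.D_nonneg _ a b)
          _ = t⁻¹ * (K.D (φ k) a b * t ^ (φ k)) := by ring
  · -- finite first moment of `M̂`
    show Summable fun k : ℕ => (k : ℝ) * hatM K χ k a b
    have hχa := hK.le_one a; have hχb := hK.le_one b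
    set δ : ℤ := (χ a : ℤ) - χ b with hδ
    set g : ℕ → ℝ := fun n => (n : ℝ) * K.M n a b with hgdef
    have hg0 : ∀ n, 0 ≤ g n := fun n => mul_nonneg (Nat.cast_nonneg _) (K.M_nonneg n a b)
    set φ : ℕ → ℕ := fun k => (2 * (k : ℤ) + δ).toNat with hφdef
    have hφ : Function.Injective φ := by
      intro k k' h
      rw [hφdef] at h; simp only at h; omega
    have hgφ : Summable (g ∘ φ) := (hmean a b).comp_injective hφ
    refine hgφ.of_nonneg_of_le (fun k => mul_nonneg (Nat.cast_nonneg _) ?_) fun k => ?_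
    · show 0 ≤ zslice K.M (glen χ k a b) a b
      simp only [zslice]; split_ifs
      · exact K.M_nonneg _ a b
      · exact le_rfl
    · show (k : ℝ) * zslice K.M (glen χ k a b) a b ≤ (g ∘ φ) k
      simp only [Function.comp, hgdef]
      rcases lt_or_ge (glen χ k a b) 0 with hneg | hnn
      · rw [zslice_neg _ hneg, mul_zero]; exact hg0 _
      · have hn : ((φ k : ℕ) : ℤ) = glen χ k a b := by rw [hφdef]; simp only; rw [hδ, glen] at *; omega
        rw [← hn, zslice_natCast]
        refine mul_le_mul_of_nonneg_right ?_ (K.M_nonneg _ a b)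
        have : (k : ℤ) ≤ ((φ k : ℕ) : ℤ) := by rw [hn, glen]; rw [glen] at hnn; omega
        exact_mod_cast this
  · -- aperiodicity along the parity class
    obtain ⟨o, ho⟩ := haper
    refine ⟨o, ?_⟩
    have hset : {m : ℕ | 0 < (hat K χ hK).D m o o} = {k : ℕ | 0 < K.D (2 * k) o o} := by
      ext k
      simp only [Set.mem_setOf_eq]
      have : (hat K χ hK).D k o o = K.D (2 * k) o o := by
        show zslice K.D (glen χ k o o) o o = _
        rw [show glen χ k o o = ((2 * k : ℕ) : ℤ) by rw [glen]; push_cast; ring, zslice_natCast]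
      rw [this]
    rw [hset]; exact ho

/-! ### §3 ★★★ The coefficient renewal theorem in the period-two (ℤ/2-graded) case -/

/-- ★★★ **THE PERIOD-TWO COEFFICIENT RENEWAL THEOREM**: for a `ℤ/2`-graded matrix renewal pair with summable generating functions on
`[0,1)`, Abelian limits `(1 − s) Σ_m D(m)_{ab} s^m → L_{ab} > 0`, finite first moment of `M`, and `gcd {k : D(2k)_{oo} > 0} = 1` at one
level, the coefficients converge ALONG THE PARITY CLASSES: `D(2k + χ_a − χ_b)_{ab} ⟶ 2 L_{ab}` — stated through the hat pair.
[cite: Feller1968, XIII.3 (periodic recurrent events: u_{nλ} → λ/μ), XIII.11; MadrasSlade1993, Theorem 4.2.2 (b); lane «pcv-sawmu» a-p2 g21 — own arrangement on the classical template] -/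
theorem tendsto_hat_coeff (hK : K.Graded₂ χ) {L : ι → ι → ℝ}
    (hsum : ∀ (a b : ι) (s : ℝ), 0 ≤ s → s < 1 → Summable fun m => K.D m a b * s ^ m)
    (habel : ∀ a b : ι, Tendsto (fun s : ℝ => (1 - s) * ∑' m, K.D m a b * s ^ m) (𝓝[<] 1) (𝓝 (L a b)))
    (hpos : ∀ a b : ι, 0 < L a b) (hmean : ∀ a b : ι, Summable fun j : ℕ => (j : ℝ) * K.M j a b)
    (haper : ∃ o : ι, Nat.setGcd {k : ℕ | 0 < K.D (2 * k) o o} = 1) (a b : ι) :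
    Tendsto (fun k : ℕ => hatD K χ k a b) atTop (𝓝 (2 * L a b)) :=
  (hat K χ hK).tendsto_coeff (hat_critical hK hsum habel hpos hmean haper) a b

/-- ★★★ Same parity: `D(2k)_{ab} → 2L_{ab}` when `χ_a = χ_b`. [cite: Feller1968, XIII.3; lane «pcv-sawmu» a-p2 g21] -/
theorem tendsto_coeff_even (hK : K.Graded₂ χ) {L : ι → ι → ℝ}
    (hsum : ∀ (a b : ι) (s : ℝ), 0 ≤ s → s < 1 → Summable fun m => K.D m a b * s ^ m)
    (habel : ∀ a b : ι, Tendsto (fun s : ℝ => (1 - s) * ∑' m, K.D m a b * s ^ m) (𝓝[<] 1) (𝓝 (L a b)))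
    (hpos : ∀ a b : ι, 0 < L a b) (hmean : ∀ a b : ι, Summable fun j : ℕ => (j : ℝ) * K.M j a b)
    (haper : ∃ o : ι, Nat.setGcd {k : ℕ | 0 < K.D (2 * k) o o} = 1) {a b : ι} (hab : χ a = χ b) :
    Tendsto (fun k : ℕ => K.D (2 * k) a b) atTop (𝓝 (2 * L a b)) := by
  refine (tendsto_hat_coeff hK hsum habel hpos hmean haper a b).congr fun k => ?_
  show zslice K.D (glen χ k a b) a b = _
  rw [show glen χ k a b = ((2 * k : ℕ) : ℤ) by rw [glen, hab]; push_cast; ring, zslice_natCast]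

/-- ★★★ Opposite parity: `D(2k+1)_{ab} → 2L_{ab}` when `χ_a ≠ χ_b`. [cite: Feller1968, XIII.3; lane «pcv-sawmu» a-p2 g21] -/
theorem tendsto_coeff_odd (hK : K.Graded₂ χ) {L : ι → ι → ℝ}
    (hsum : ∀ (a b : ι) (s : ℝ), 0 ≤ s → s < 1 → Summable fun m => K.D m a b * s ^ m)
    (habel : ∀ a b : ι, Tendsto (fun s : ℝ => (1 - s) * ∑' m, K.D m a b * s ^ m) (𝓝[<] 1) (𝓝 (L a b)))
    (hpos : ∀ a b : ι, 0 < L a b) (hmean : ∀ a b : ι, Summable fun j : ℕ => (j : ℝ) * K.M j a b)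
    (haper : ∃ o : ι, Nat.setGcd {k : ℕ | 0 < K.D (2 * k) o o} = 1) {a b : ι} (hab : χ a ≠ χ b) :
    Tendsto (fun k : ℕ => K.D (2 * k + 1) a b) atTop (𝓝 (2 * L a b)) := by
  have hχa := hK.le_one a; have hχb := hK.le_one b
  have h := tendsto_hat_coeff hK hsum habel hpos hmean haper a b
  rcases Nat.lt_or_gt_of_ne hab with hlt | hgt
  · -- `χ_a = 0`, `χ_b = 1`: `D̂(k+1) = D(2k+1)`
    refine ((h.comp (tendsto_add_atTop_nat 1))).congr fun k => ?_
    show zslice K.D (glen χ (k + 1) a b) a b = _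
    rw [show glen χ (k + 1) a b = ((2 * k + 1 : ℕ) : ℤ) by rw [glen]; push_cast; omega, zslice_natCast]
  · -- `χ_a = 1`, `χ_b = 0`: `D̂(k) = D(2k+1)`
    refine h.congr fun k => ?_
    show zslice K.D (glen χ k a b) a b = _
    rw [show glen χ k a b = ((2 * k + 1 : ℕ) : ℤ) by rw [glen]; push_cast; omega, zslice_natCast]

end RenewalKernelPair

end Literature.Probability.Process
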